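import Summits.QuantumAdvantage.QuantumAdvantage.Theorems.CharDialJLinSlice
import Summits.QuantumAdvantage.QuantumAdvantage.Theorems.CharDialFormJunta
import Summits.QuantumAdvantage.AdviceFreeQNC0.WalkHardFJuntaCuts
import HarnessLib

/-!
# CharDial's aside `stmt-QuantumAdvantage-27049` (`CharDial.RankOneHardJLinOdd`, piece R1 of SliceDial) PROVED BY NAME

decomp-qadv lens-6 («barrier-complement carving») g11, rev 7 tree part 17.  Prop-free, sorry-free.  IMPORTS two earlier
parts of the same LAND package — part 12 `CharDialJLinSlice.lean` (`JLinPeel.rankOne_of_dense`: rank-one hardness follows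
from its DENSE-direction case, the sparse directions being sliced into coordinate subcubes; `JLinData.blindCuts`) and
part 16 `CharDialFormJunta.lean` (`WindowCounter.formJunta_small`: the dense-direction junta bias; `form_reduction`: the
form-dial Fourier reduction) — so it lands THIRD.

`charDial_rankOneHardJLinOdd : CharDial.RankOneHardJLinOdd` — for every prime `p ≥ 5` there are `θ < 1` and `n₀` such
that every junta ⊕ linear-form datum `D : JLinData p n` (`n ≥ n₀`) with `log₂ n`-juntas whose NON-BLIND cuts' forms are all
proportional to ONE direction `a` (RANK ONE) presents a strategy winning α's u-walk game on at most `θ·2ⁿ` inputs.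
PROOF.  Dense `a` (`2·#supp a > n`): re-present the pencil through the tables (`h_g(u,s) ↦ h_g(u, l_g s)`,
`exists_commonDir`), so the strategy is the FORM DIAL `u ↦ Y_{⟨a,u⟩}(·,u)` of a family of `log₂ n`-junta strategies
(`strat_eq_formStrat`); the junta rung `walkHardFJuntaCuts` (rate `θ₀`) and `formJunta_small` feed `form_reduction`
(rate `(1+θ₀)/2`, `juntaForm_hard`).  Sparse `a`: `rankOne_of_dense` at `δ₀ = 1/2`.
-/

open Finset

namespace Summit.QuantumAdvantage.AdviceFreeQNC0.JLinPeel

open Summit.QuantumAdvantage.AdviceFreeQNC0 JLinData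

variable {p : ℕ} {n : ℕ}

/-- the tree's junta rung at exponent `1` (`walkHardFJuntaCuts`, `p ≠ 3`) in the shape `form_reduction` wants. -/
theorem logJunta_hard (p : ℕ) [Fact p.Prime] (hp3 : p ≠ 3) : ∃ θ₀ : ℝ, θ₀ < 1 ∧ ∃ n₀ : ℕ, ∀ n ≥ n₀, ∀ (c : ℕ)
    (y : Fin (n + 1) → (Fin n → Bool) → Bool),
      (∀ g, ∃ J : Finset (Fin n), J.card ≤ Nat.log 2 n ∧ ∀ u v : Fin n → Bool, (∀ i ∈ J, u i = v i) → y g u = y g v) →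
        (#{u : Fin n → Bool | ringWinU c y u = true} : ℝ) ≤ θ₀ * 2 ^ n := by
  obtain ⟨θ, hθ, H⟩ := walkHardFJuntaCuts p hp3
  obtain ⟨n₀, hn₀⟩ := H 1
  refine ⟨θ, hθ, n₀, fun n hn c y hy => hn₀ n hn c y fun g => ?_⟩
  obtain ⟨J, hJ, hdep⟩ := hy g
  exact ⟨J, by rw [pow_one]; exact hJ, hdep⟩

/-- **`log₂ n`-junta ⊕ one-form strategies lose in DENSE directions** (rate `(1 + θ₀)/2`; `form_reduction` fed with the
junta rung and the junta bias `formJunta_small`). -/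
theorem juntaForm_hard (p : ℕ) [Fact p.Prime] (hp : 5 ≤ p) :
    ∃ θ : ℝ, θ < 1 ∧ ∃ n₂ : ℕ, ∀ n ≥ n₂, ∀ (c : ℕ) (a : Fin n → ZMod p)
      (Y : ZMod p → Fin (n + 1) → (Fin n → Bool) → Bool), n ≤ 2 * (univ.filter fun i : Fin n => a i ≠ 0).card →
        (∀ s g, ∃ J : Finset (Fin n), J.card ≤ Nat.log 2 n ∧ ∀ u v : Fin n → Bool, (∀ i ∈ J, u i = v i) →
          Y s g u = Y s g v) →
        (#{u : Fin n → Bool | ringWinU c (WindowCounter.formStrat p a Y) u = true} : ℝ) ≤ θ * 2 ^ n := by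
  obtain ⟨θ₀, hθ₀, h1⟩ := logJunta_hard p (by omega)
  obtain ⟨n₂, h⟩ := WindowCounter.form_reduction p
    (fun {n} _ y => ∀ g, ∃ J : Finset (Fin n), J.card ≤ Nat.log 2 n ∧ ∀ u v : Fin n → Bool,
      (∀ i ∈ J, u i = v i) → y g u = y g v) h1 (WindowCounter.formJunta_small p hp) hθ₀
  exact ⟨θ₀ + (1 - θ₀) / 2, by linarith, n₂, fun n hn c a Y hd hY => h n hn c a Y hd hY⟩

/-- with a common direction the strategy IS the form dial of its tables. -/
theorem strat_eq_formStrat [Fact p.Prime] (D : JLinData p n) {a : Fin n → ZMod p} (ha : ∀ g, D.a g = a) :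
    D.strat = WindowCounter.formStrat p a (fun s g u => D.h g u s) := by
  funext g u
  simp only [JLinData.strat, JLinData.form, WindowCounter.formStrat, WindowCounter.linF, ha]

/-- **re-presenting a rank-one pencil** `a_g = l_g • a` (non-blind cuts) through the tables, `h'_g(u,s) = h_g(u, l_g s)`
(a blind cut ignores the form value anyway): the SAME strategy with the same juntas and ALL forms equal to `a`. -/
theorem exists_commonDir (D : JLinData p n) {a : Fin n → ZMod p}
    (ha : ∀ g, g ∉ D.blindCuts → ∃ l : ZMod p, D.a g = fun i => l * a i) :
    ∃ D' : JLinData p n, D'.J = D.J ∧ (∀ g, D'.a g = a) ∧ D'.strat = D.strat := by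
  classical
  have hl : ∀ g, ∃ l : ZMod p, g ∉ D.blindCuts → D.a g = fun i => l * a i := fun g => by
    by_cases hb : g ∈ D.blindCuts
    · exact ⟨0, fun h => (h hb).elim⟩
    · obtain ⟨l, hl⟩ := ha g hb
      exact ⟨l, fun _ => hl⟩
  choose l hl using hl
  let D' : JLinData p n :=
    { J := D.J, a := fun _ => a, h := fun g u s => D.h g u (l g * s), hJ := fun g u v huv s => D.hJ g u v huv _ }
  refine ⟨D', rfl, fun _ => rfl, ?_⟩
  funext g u
  show D.h g u (l g * ∑ i, if u i then a i else 0) = D.h g u (D.form g u)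
  by_cases hb : g ∈ D.blindCuts
  · exact (JLinData.mem_blindCuts D).1 hb u _ _
  · simp only [JLinData.form, hl g hb, mul_sum, mul_ite, mul_zero]

/-- **PIECE R1 OF SLICEDIAL, = CharDial's aside `stmt-QuantumAdvantage-27049`, PROVED BY NAME**: for every prime `p ≥ 5`,
junta ⊕ linear-form data with `log₂ n`-juntas whose non-blind cuts share ONE form direction lose α's u-walk game. -/
theorem charDial_rankOneHardJLinOdd : Summit.QuantumAdvantage.QuantumAdvantage.Theses.CharDial.RankOneHardJLinOdd := by
  intro p _ hp
  obtain ⟨θ, hθ, n₀, h⟩ := rankOne_of_dense (p := p) (δ₀ := (1 / 2 : ℝ)) (by norm_num) (by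
    obtain ⟨θ, hθ, n₂, h⟩ := juntaForm_hard p hp
    refine ⟨θ, hθ, n₂, fun n hn c D hJ hR => ?_⟩
    obtain ⟨a, hdense, ha⟩ := hR
    obtain ⟨D', hJ', ha', hstrat⟩ := exists_commonDir D ha
    rw [← hstrat, strat_eq_formStrat D' ha']
    have hd : n ≤ 2 * (univ.filter fun i : Fin n => a i ≠ 0).card := by
      have h' : (n : ℝ) < 2 * ((univ.filter fun i : Fin n => a i ≠ 0).card : ℝ) := by linarith
      exact_mod_cast h'.le
    exact h n hn c a _ hd fun s g => ⟨D'.J g, by rw [hJ']; exact hJ g, fun u v huv => D'.hJ g u v huv _⟩)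
  refine ⟨θ, hθ, n₀, fun n hn c D hJ hR => ?_⟩
  obtain ⟨a, ha⟩ := hR
  exact h n hn c D hJ ⟨a, fun g hg => ha g fun hb => hg ((JLinData.mem_blindCuts D).2 hb)⟩

end Summit.QuantumAdvantage.AdviceFreeQNC0.JLinPeel
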